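import Mathlib
import Literature.AlgebraicGeometry.Tropical.InitialIdeal
import Summits.ResolutionOfSingularities.ResolutionOfSingularities.Theorems.TropicalLinksInductiveStepOffTropical

/-!
# Crux `InductiveStep` (stmt-ResolutionOfSingularities-17233) — negative knowledge: the degeneration of a
# torus complement `𝔾_m^N ∖ V(G₀)` at the LEG weight is `V(G₀) × 𝔾_m`

Route `ResolutionOfSingularities/TropicalLinks`, crux `InductiveStep` (≡ `SchonPlus`), line `split`, stub
`stub_sncClosureSchon` (cdisprove seat, gen 2 / cycle 1, part 3; parts 1–2: `AboveGraphLegKernel.lean`,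
`AboveGraphNotVacuous.lean`).  Datum: any field `k`, any `N`, `I = ⊥ ⊆ k[ℤ^N]` (`U = 𝔾_m^N`, prime,
`d = N`), ONE unit `G₀ ≠ 0` (`m = 1`), the route's re-embedding `I' = ⟨ι(⊥), y − ι G₀⟩ = ⟨y − G₀⟩` in
`k[ℤ^(N+1)]`, and the LEG weight `w = (0,…,0,1)` — the weight `1` of `y` lies strictly ABOVE the weight
`0` of every monomial of `G₀` (so neither landed vacuity brick p160703 / p160862 applies when `G₀` has
≥ 2 terms).

* `inductiveStep_torusLeg_inIdeal_eq_span` — **`in_w(I') = (ι G₀)` EXACTLY**: the initial degeneration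
  of `U[G₀⁻¹]` at the leg is `V(G₀) × 𝔾_m ⊆ 𝔾_m^N × 𝔾_m` (generalising and sharpening part 1, where
  `N = 1`, `G₀ = x − 1` and only `⟨x − 1⟩ ≤ in_w(I') ≤ ker(x ↦ 1)` was recorded).
  `≤` (`inductiveStep_torusLeg_inIdeal_le_span`): every `f ∈ I'` dies under `x ↦ X, y ↦ G₀(X)` into
  `Frac k[X^±]`; by the `G₀`-ADIC ORDER (`inductiveStep_torusLeg_bottom_mem_span`,
  `inductiveStep_torusLeg_layer_mem_span`) the bottom `w`-layer of `f` — i.e. `in_w(f)` up to the unit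
  `y^min` — lies in `(G₀)`.  `≥` (`inductiveStep_torusLeg_span_le_inIdeal`): the initial form of the
  generator `y − ι G₀` is `−ι G₀` (`inductiveStep_torusLeg_initialForm_single_sub`, the mirror image of
  `Theorems.tropicalLinks_initialForm_single_sub_eq`).

CONSEQUENCE (made explicit in part 4, `TorusLegNode.lean`, with the node `G₀ = (x₁ − 1)(x₂ − 1)`): the
schön clause of `SchonAt` at the leg asks that `V(G₀) ∩ 𝔾_m^N` be REGULAR — removing a hypersurface
re-embeds its LINK as a leg degeneration, so the units `G_j` must be CHOSEN with regular (indeed schön)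
zero loci: step (iii) "Bertini" and the link repair of step (ii) of the crux's intended proof are
load-bearing, and a careless unit destroys schön-ness even for `U = 𝔾_m^N`.

All statements use the route's INLINED `ι`, `y_j` and generating set of `I'`, with the tree's
`Literature…Tropical.weightInitialIdeal` for `in_w` (convertible to the route's inlined span by the
landed bridge `Theorems.tropicalLinks_weightInitialIdeal_eq_span`, any decidability instance).
-/

-- single-problem summit: the doubled namespace component `ResolutionOfSingularities` is forced
set_option linter.dupNamespace false

namespace Summit.ResolutionOfSingularities.ResolutionOfSingularities.Theorems.InductiveStep.Negative

open AddMonoidAlgebra Literature.AlgebraicGeometry.Tropical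
open scoped Classical

/-- The leg weight `w = (0,…,0,1)` on `k[ℤ^(N+1)]` weighs an exponent by its last component. [folklore] -/
theorem inductiveStep_torusLeg_dotWeight (N : ℕ) (v : Fin (N + 1) → ℤ) :
    dotWeight (Fin.append (0 : Fin N → ℤ) (1 : Fin 1 → ℤ)) v = v (Fin.natAdd N 0) := by
  rw [dotWeight_apply, Fin.sum_univ_add]
  simp only [Fin.append_left, Fin.append_right, Pi.zero_apply, Pi.one_apply, zero_mul, one_mul,
    Finset.sum_const_zero, zero_add, Fin.sum_univ_one]

/-- Step A' (`G`-adic order, bottom layer): in the Laurent polynomial ring `k[ℤ^N]`, if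
`Σ_{v ∈ S} x^(π v) c_v · G^(t_v) = 0` with natural exponents `t_v` that vanish exactly on the layer
`S₀ ⊆ S`, then the layer sum `Σ_{v ∈ S₀} c_v x^(π v)` lies in the ideal `(G)`. [folklore] -/
theorem inductiveStep_torusLeg_layer_mem_span {k : Type} [Field k] {N : ℕ} {α : Type}
    (S : Finset α) (a : α → AddMonoidAlgebra k (Fin N → ℤ)) (t : α → ℕ) (G : AddMonoidAlgebra k (Fin N → ℤ))
    (p : α → Prop) [DecidablePred p] (hp : ∀ v ∈ S, (p v ↔ t v = 0))
    (h : ∑ v ∈ S, a v * G ^ (t v) = 0) :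
    ∑ v ∈ S.filter p, a v ∈ Ideal.span {G} := by
  rw [← Finset.sum_filter_add_sum_filter_not S p] at h
  have hA : ∑ v ∈ S.filter p, a v * G ^ (t v) = ∑ v ∈ S.filter p, a v := by
    refine Finset.sum_congr rfl fun v hv => ?_
    rw [Finset.mem_filter] at hv
    rw [(hp v hv.1).1 hv.2, pow_zero, mul_one]
  have hB : ∑ v ∈ S.filter (fun v => ¬ p v), a v * G ^ (t v) =
      (∑ v ∈ S.filter (fun v => ¬ p v), a v * G ^ (t v - 1)) * G := by
    rw [Finset.sum_mul]
    refine Finset.sum_congr rfl fun v hv => ?_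
    rw [Finset.mem_filter] at hv
    have ht : t v ≠ 0 := fun h0 => hv.2 ((hp v hv.1).2 h0)
    rw [mul_assoc, ← pow_succ, Nat.sub_add_cancel (Nat.one_le_iff_ne_zero.2 ht)]
  rw [hA, hB] at h
  rw [eq_neg_of_add_eq_zero_left h]
  exact neg_mem_iff.2 (Ideal.mul_mem_left _ _ (Ideal.mem_span_singleton_self G))

/-- Step B' (`G`-adic order in the fraction field): if `Σ_{v ∈ S} c_v X^(π v) · G^(v_last) = 0` in a field
`K ⊇ k[ℤ^N]` (integer powers of the unit `G` of `K`), then the bottom layer `v_last = min` of the family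
lies in `(G)`: multiply by `G^(−min)` and apply Step A'. [folklore] -/
theorem inductiveStep_torusLeg_bottom_mem_span (k : Type) [Field k] (N : ℕ) (K : Type) [Field K]
    [Algebra (AddMonoidAlgebra k (Fin N → ℤ)) K]
    (hinj : Function.Injective (algebraMap (AddMonoidAlgebra k (Fin N → ℤ)) K))
    (G : AddMonoidAlgebra k (Fin N → ℤ)) (hG : algebraMap (AddMonoidAlgebra k (Fin N → ℤ)) K G ≠ 0)
    (S : Finset (Fin (N + 1) → ℤ)) (hS : S.Nonempty) (c : (Fin (N + 1) → ℤ) → k)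
    (h : ∑ v ∈ S, algebraMap (AddMonoidAlgebra k (Fin N → ℤ)) K
        (single (fun i : Fin N => v (Fin.castAdd 1 i)) (c v)) *
        (algebraMap (AddMonoidAlgebra k (Fin N → ℤ)) K G) ^ (v (Fin.natAdd N 0)) = 0) :
    ∑ v ∈ S.filter (fun v => v (Fin.natAdd N 0) = S.inf' hS (fun v => v (Fin.natAdd N 0))),
      single (fun i : Fin N => v (Fin.castAdd 1 i)) (c v) ∈ Ideal.span {G} := by
  set gK : K := algebraMap (AddMonoidAlgebra k (Fin N → ℤ)) K G with hgK
  set μ₀ : ℤ := S.inf' hS (fun v => v (Fin.natAdd N 0)) with hμ₀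
  have hμ : ∀ v ∈ S, μ₀ ≤ v (Fin.natAdd N 0) := fun v hv =>
    Finset.inf'_le (fun v : Fin (N + 1) → ℤ => v (Fin.natAdd N 0)) hv
  -- multiply the relation by `gK^(−μ₀)`: all exponents become natural numbers
  have h2 : algebraMap (AddMonoidAlgebra k (Fin N → ℤ)) K (∑ v ∈ S,
      single (fun i : Fin N => v (Fin.castAdd 1 i)) (c v) * G ^ (v (Fin.natAdd N 0) - μ₀).toNat) = 0 := by
    have h' := congrArg (fun t => gK ^ (-μ₀) * t) h
    simp only [mul_zero, Finset.mul_sum] at h'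
    rw [map_sum, ← h']
    refine Finset.sum_congr rfl fun v hv => ?_
    have hto : (((v (Fin.natAdd N 0) - μ₀).toNat : ℕ) : ℤ) = -μ₀ + v (Fin.natAdd N 0) := by
      rw [Int.toNat_of_nonneg (sub_nonneg.2 (hμ v hv))]
      ring
    rw [map_mul, map_pow, ← hgK, ← zpow_natCast, hto, zpow_add₀ hG]
    ring
  have h3 : ∑ v ∈ S, single (fun i : Fin N => v (Fin.castAdd 1 i)) (c v) *
      G ^ (v (Fin.natAdd N 0) - μ₀).toNat = 0 := hinj (by rw [h2, map_zero])
  refine inductiveStep_torusLeg_layer_mem_span S _ (fun v => (v (Fin.natAdd N 0) - μ₀).toNat) G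
    (fun v => v (Fin.natAdd N 0) = μ₀) (fun v hv => ?_) h3
  rw [Int.toNat_eq_zero]
  constructor
  · intro h0; rw [h0, sub_self]
  · intro h0; exact le_antisymm (by linarith) (hμ v hv)

/-- The lattice embedding `ℤ^N → ℤ^(N+1)`, `v ↦ (v, 0)`, is additive. [folklore] -/
theorem inductiveStep_torusLeg_append_add (N : ℕ) (u v : Fin N → ℤ) (a b : Fin 1 → ℤ) :
    Fin.append (u + v) (a + b) = Fin.append u a + Fin.append v b := by
  funext i
  refine Fin.addCases (fun i => ?_) (fun i => ?_) i
  · simp only [Fin.append_left, Pi.add_apply]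
  · simp only [Fin.append_right, Pi.add_apply]

/-- An exponent of `ℤ^(N+1)` is its head glued to its last component. [folklore] -/
theorem inductiveStep_torusLeg_append_split (N : ℕ) (v : Fin (N + 1) → ℤ) :
    Fin.append (fun i : Fin N => v (Fin.castAdd 1 i)) (0 : Fin 1 → ℤ) +
      Fin.append (0 : Fin N → ℤ) (fun _ : Fin 1 => v (Fin.natAdd N 0)) = v := by
  funext i
  refine Fin.addCases (fun i => ?_) (fun i => ?_) i
  · simp only [Pi.add_apply, Fin.append_left, Pi.zero_apply, add_zero]
  · rw [Fin.fin_one_eq_zero i]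
    simp only [Pi.add_apply, Fin.append_right, Pi.zero_apply, zero_add]

set_option maxHeartbeats 800000 in
/-- **The degeneration of `𝔾_m^N ∖ V(G)` at the leg lies inside `V(G) × 𝔾_m` (kernel lemma).**  For a
field `k`, `I = ⊥ ⊆ k[ℤ^N]` (`U = 𝔾_m^N`), ONE unit `G₀ ≠ 0` and the route's re-embedding
`I' = ⟨ι(⊥), y − ι(G₀)⟩ = ⟨y − G₀⟩ ⊆ k[ℤ^(N+1)]`, the initial ideal at the LEG weight `w = (0,…,0,1)`
(the weight `1` of `y` is strictly ABOVE the weight `0` of every monomial of `G₀`) satisfies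
`in_w(I') ≤ (ι G₀)`.  Proof: each `f ∈ I'` dies under `x ↦ X, y ↦ G₀(X)` into `Frac k[X^±]`; by the
`G₀`-adic order (`inductiveStep_torusLeg_bottom_mem_span`) the bottom `w`-layer of `f` — which is
`in_w(f) · y^(−min)` — lies in `(G₀)`. [folklore] -/
theorem inductiveStep_torusLeg_inIdeal_le_span (k : Type) [Field k] (N : ℕ)
    (G : Fin 1 → AddMonoidAlgebra k (Fin N → ℤ)) (hG : G 0 ≠ 0) :
    weightInitialIdeal (Fin.append (0 : Fin N → ℤ) (1 : Fin 1 → ℤ)) (Ideal.span ((fun f : AddMonoidAlgebra k (Fin N → ℤ) => (AddMonoidAlgebra.ofCoeff (f.coeff.mapDomain fun v => Fin.append v (0 : Fin 1 → ℤ)) : AddMonoidAlgebra k (Fin (N + 1) → ℤ))) '' (↑(⊥ : Ideal (AddMonoidAlgebra k (Fin N → ℤ))) : Set (AddMonoidAlgebra k (Fin N → ℤ))) ∪ Set.range (fun j : Fin 1 => AddMonoidAlgebra.single (Fin.append (0 : Fin N → ℤ) (Pi.single j (1 : ℤ))) (1 : k) - AddMonoidAlgebra.ofCoeff ((G j).coeff.mapDomain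 fun v => Fin.append v (0 : Fin 1 → ℤ))))) ≤ Ideal.span {(AddMonoidAlgebra.ofCoeff ((G 0).coeff.mapDomain fun v => Fin.append v (0 : Fin 1 → ℤ)) : AddMonoidAlgebra k (Fin (N + 1) → ℤ))} := by
  -- the lattice embedding `ι` as a `k`-algebra map, agreeing with the route's inlined term
  let ιₐ : AddMonoidAlgebra k (Fin N → ℤ) →ₐ[k] AddMonoidAlgebra k (Fin (N + 1) → ℤ) :=
    AddMonoidAlgebra.mapDomainAlgHom k k
      { toFun := fun v => Fin.append v (0 : Fin 1 → ℤ)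
        map_zero' := by
          funext i
          exact Fin.addCases (fun i => by rw [Fin.append_left]; rfl) (fun i => by rw [Fin.append_right]; rfl) i
        map_add' := fun u v => by
          have := inductiveStep_torusLeg_append_add N u v 0 0
          rwa [add_zero] at this }
  have hι : ∀ f : AddMonoidAlgebra k (Fin N → ℤ), ιₐ f =
      AddMonoidAlgebra.ofCoeff (f.coeff.mapDomain fun v => Fin.append v (0 : Fin 1 → ℤ)) := fun f => rfl
  have hι_single : ∀ (v : Fin N → ℤ) (c : k), ιₐ (single v c) = single (Fin.append v (0 : Fin 1 → ℤ)) c := by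
    intro v c
    rw [AddMonoidAlgebra.mapDomainAlgHom_apply, AddMonoidAlgebra.mapDomain_single]
    rfl
  clear_value ιₐ
  rw [← hι (G 0)]
  generalize hT : ((fun f : AddMonoidAlgebra k (Fin N → ℤ) => (AddMonoidAlgebra.ofCoeff (f.coeff.mapDomain fun v => Fin.append v (0 : Fin 1 → ℤ)) : AddMonoidAlgebra k (Fin (N + 1) → ℤ))) '' (↑(⊥ : Ideal (AddMonoidAlgebra k (Fin N → ℤ))) : Set (AddMonoidAlgebra k (Fin N → ℤ))) ∪ Set.range (fun j : Fin 1 => AddMonoidAlgebra.single (Fin.append (0 : Fin N → ℤ) (Pi.single j (1 : ℤ))) (1 : k) - AddMonoidAlgebra.ofCoeff ((G j).coeff.mapDomain fun v => Fin.append v (0 : Fin 1 → ℤ)))) = T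
  generalize hw : (Fin.append (0 : Fin N → ℤ) (1 : Fin 1 → ℤ)) = w
  -- the algebra map `θ : k[x^±, y^±] → Frac k[X^±]`, `x ↦ X`, `y ↦ G₀`
  set K := FractionRing (AddMonoidAlgebra k (Fin N → ℤ)) with hK
  have hinj : Function.Injective (algebraMap (AddMonoidAlgebra k (Fin N → ℤ)) K) :=
    IsFractionRing.injective (AddMonoidAlgebra k (Fin N → ℤ)) K
  set gK : K := algebraMap (AddMonoidAlgebra k (Fin N → ℤ)) K (G 0) with hgK
  have hg0 : gK ≠ 0 := fun h0 => hG (hinj (by rw [map_zero]; exact h0))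
  let φ₀ : Multiplicative (Fin (N + 1) → ℤ) →* K :=
    { toFun := fun v => algebraMap (AddMonoidAlgebra k (Fin N → ℤ)) K
          (single (fun i : Fin N => Multiplicative.toAdd v (Fin.castAdd 1 i)) (1 : k)) *
        gK ^ (Multiplicative.toAdd v (Fin.natAdd N 0))
      map_one' := by
        simp only [toAdd_one, Pi.zero_apply, zpow_zero, mul_one]
        exact map_one (algebraMap (AddMonoidAlgebra k (Fin N → ℤ)) K)
      map_mul' := fun a b => by
        simp only [toAdd_mul, Pi.add_apply, zpow_add₀ hg0]
        rw [show (fun i : Fin N => Multiplicative.toAdd a (Fin.castAdd 1 i) + Multiplicative.toAdd b (Fin.castAdd 1 i)) =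
            (fun i : Fin N => Multiplicative.toAdd a (Fin.castAdd 1 i)) + (fun i : Fin N => Multiplicative.toAdd b (Fin.castAdd 1 i)) from rfl,
          show (single ((fun i : Fin N => Multiplicative.toAdd a (Fin.castAdd 1 i)) + (fun i : Fin N => Multiplicative.toAdd b (Fin.castAdd 1 i))) (1 : k) : AddMonoidAlgebra k (Fin N → ℤ)) =
            single (fun i : Fin N => Multiplicative.toAdd a (Fin.castAdd 1 i)) 1 * single (fun i : Fin N => Multiplicative.toAdd b (Fin.castAdd 1 i)) 1 by
              rw [single_mul_single, one_mul], map_mul]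
        ring }
  have hφ₀ : ∀ v : Fin (N + 1) → ℤ, φ₀ (Multiplicative.ofAdd v) =
      algebraMap (AddMonoidAlgebra k (Fin N → ℤ)) K (single (fun i : Fin N => v (Fin.castAdd 1 i)) (1 : k)) *
        gK ^ (v (Fin.natAdd N 0)) := fun v => rfl
  clear_value φ₀
  set θ : AddMonoidAlgebra k (Fin (N + 1) → ℤ) →ₐ[k] K :=
    AddMonoidAlgebra.lift k K (Fin (N + 1) → ℤ) φ₀ with hθ
  have hθ_single : ∀ (v : Fin (N + 1) → ℤ) (a : k), θ (single v a) =
      algebraMap (AddMonoidAlgebra k (Fin N → ℤ)) K (single (fun i : Fin N => v (Fin.castAdd 1 i)) a) *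
        gK ^ (v (Fin.natAdd N 0)) := by
    intro v a
    rw [hθ, lift_single, hφ₀, Algebra.smul_def, IsScalarTower.algebraMap_apply k (AddMonoidAlgebra k (Fin N → ℤ)) K,
      ← mul_assoc, ← map_mul]
    congr 2
    simp only [coe_algebraMap, Algebra.algebraMap_self, RingHom.coe_id, Function.comp_apply, id_eq]
    rw [single_mul_single, zero_add, mul_one]
  -- `θ ∘ ι = algebraMap`
  have hθι : ∀ f : AddMonoidAlgebra k (Fin N → ℤ), θ (ιₐ f) = algebraMap (AddMonoidAlgebra k (Fin N → ℤ)) K f := by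
    have hcomp : θ.comp ιₐ = IsScalarTower.toAlgHom k (AddMonoidAlgebra k (Fin N → ℤ)) K := by
      apply AddMonoidAlgebra.algHom_ext
      · intro v
        rw [AlgHom.comp_apply, hι_single, hθ_single, IsScalarTower.toAlgHom_apply]
        have h1 : (fun i : Fin N => Fin.append v (0 : Fin 1 → ℤ) (Fin.castAdd 1 i)) = v := by
          funext i; rw [Fin.append_left]
        rw [h1, Fin.append_right, Pi.zero_apply, zpow_zero, mul_one]
      · exact Subsingleton.elim _ _
    intro f
    exact DFunLike.congr_fun hcomp f
  -- (1) `I' ≤ ker θ`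
  have hTθ : Ideal.span T ≤ RingHom.ker θ.toRingHom := by
    rw [Ideal.span_le, ← hT]
    rintro t (⟨f, hf, rfl⟩ | ⟨j, rfl⟩)
    · have hf0 : f = 0 := by simpa using hf
      subst hf0
      simp only [SetLike.mem_coe, RingHom.mem_ker, AlgHom.toRingHom_eq_coe, RingHom.coe_coe]
      rw [coeff_zero, Finsupp.mapDomain_zero, ofCoeff_zero, map_zero]
    · obtain rfl : j = 0 := Fin.fin_one_eq_zero j
      simp only [SetLike.mem_coe, RingHom.mem_ker, AlgHom.toRingHom_eq_coe, RingHom.coe_coe]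
      rw [← hι (G 0), map_sub, hθ_single, hθι]
      have h1 : (fun i : Fin N => Fin.append (0 : Fin N → ℤ) (Pi.single (0 : Fin 1) (1 : ℤ)) (Fin.castAdd 1 i)) = 0 := by
        funext i; simp only [Fin.append_left, Pi.zero_apply]
      rw [h1, Fin.append_right, Pi.single_eq_same, zpow_one, ← one_def, map_one, one_mul, hgK, sub_self]
  -- (2) for `f ∈ I'`, the initial form lies in `(ι G₀)`
  have hkey : ∀ f ∈ Ideal.span T, initialForm (dotWeight w) f ∈ Ideal.span {ιₐ (G 0)} := by
    intro f hf
    by_cases hf0 : f = 0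
    · subst hf0
      rw [initialForm_zero]
      exact Ideal.zero_mem _
    have hS : f.coeff.support.Nonempty := by
      rw [Finsupp.support_nonempty_iff, Ne, coeff_eq_zero]
      exact hf0
    have hf_sum : ∑ v ∈ f.coeff.support, single v (f.coeff v) = f := sum_coeff_single f
    have hθf : θ f = 0 := hTθ hf
    rw [← hf_sum, map_sum] at hθf
    simp only [hθ_single] at hθf
    have hbottom := inductiveStep_torusLeg_bottom_mem_span k N K hinj (G 0) hg0 f.coeff.support hS
      (fun v => f.coeff v) hθf
    obtain ⟨q, hq⟩ := Ideal.mem_span_singleton'.1 hbottom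
    -- the initial form keeps exactly the bottom layer `v_last = μ₀`
    set μ₀ := f.coeff.support.inf' hS (fun v => v (Fin.natAdd N 0)) with hμ₀
    have hP : ∀ v ∈ f.coeff.support, ((∀ u ∈ f.coeff.support, dotWeight w v ≤ dotWeight w u) ↔
        v (Fin.natAdd N 0) = μ₀) := by
      intro v hv
      simp only [← hw, inductiveStep_torusLeg_dotWeight]
      constructor
      · intro hall
        exact le_antisymm (Finset.le_inf' hS _ hall) (Finset.inf'_le _ hv)
      · intro heq u hu
        rw [heq]
        exact Finset.inf'_le _ hu
    have hin_sum : initialForm (dotWeight w) f =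
        ∑ v ∈ f.coeff.support.filter (fun v => v (Fin.natAdd N 0) = μ₀), single v (f.coeff v) := by
      rw [← Finset.filter_congr hP, ← support_initialForm]
      conv_lhs => rw [← sum_coeff_single (initialForm (dotWeight w) f)]
      refine Finset.sum_congr rfl fun v hv => ?_
      rw [support_initialForm, Finset.mem_filter] at hv
      rw [coeff_initialForm_apply, if_pos hv.2]
    have hsplit : ∑ v ∈ f.coeff.support.filter (fun v => v (Fin.natAdd N 0) = μ₀), single v (f.coeff v) =
        ιₐ (∑ v ∈ f.coeff.support.filter (fun v => v (Fin.natAdd N 0) = μ₀),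
          single (fun i : Fin N => v (Fin.castAdd 1 i)) (f.coeff v)) *
          single (Fin.append (0 : Fin N → ℤ) (fun _ : Fin 1 => μ₀)) (1 : k) := by
      rw [map_sum, Finset.sum_mul]
      refine Finset.sum_congr rfl fun v hv => ?_
      rw [Finset.mem_filter] at hv
      rw [hι_single, single_mul_single, mul_one]
      congr 1
      rw [← hv.2]
      exact (inductiveStep_torusLeg_append_split N v).symm
    rw [hin_sum, hsplit, ← hq, map_mul]
    exact Ideal.mul_mem_right _ _ (Ideal.mul_mem_left _ _ (Ideal.mem_span_singleton_self _))
  -- (3) conclude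
  rw [weightInitialIdeal, initialIdeal, Ideal.span_le]
  rintro _ ⟨f, hf, rfl⟩
  exact hkey f hf

/-- **Initial form of `y − g` when `y` is strictly HEAVIEST and `g` is weight-homogeneous**: if every
exponent of `g ≠ 0` has weight `0` and `e` has weight `1` (for the leg weight, read through
`inductiveStep_torusLeg_dotWeight`), then `in_w(x^e − g) = −g`.  (Mirror image of
`Theorems.tropicalLinks_initialForm_single_sub_eq`, where `y` is strictly lightest.) [folklore] -/
theorem inductiveStep_torusLeg_initialForm_single_sub {k : Type} [Field k] {M : ℕ} (w : Fin M → ℤ)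
    (e : Fin M → ℤ) (g : AddMonoidAlgebra k (Fin M → ℤ)) (hg : g ≠ 0)
    (he : dotWeight w e = 1) (hg0 : ∀ u ∈ g.coeff.support, dotWeight w u = 0) :
    initialForm (dotWeight w) (single e (1 : k) - g) = -g := by
  have he_notMem : e ∉ g.coeff.support := fun h => by
    have := hg0 e h
    rw [he] at this
    exact one_ne_zero this
  have hge : g.coeff e = 0 := Finsupp.notMem_support_iff.1 he_notMem
  obtain ⟨u₀, hu₀⟩ : g.coeff.support.Nonempty := by
    rw [Finsupp.support_nonempty_iff, Ne, coeff_eq_zero]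
    exact hg
  have hf_coeff : ∀ v, (single e (1 : k) - g).coeff v = (Finsupp.single e (1 : k)) v - g.coeff v := fun v => rfl
  have hf_e : (single e (1 : k) - g).coeff e = 1 := by
    rw [hf_coeff, Finsupp.single_eq_same, hge, sub_zero]
  have hf_u : ∀ u ∈ g.coeff.support, (single e (1 : k) - g).coeff u = -g.coeff u := by
    intro u hu
    have hne : u ≠ e := fun h => he_notMem (h ▸ hu)
    rw [hf_coeff, Finsupp.single_eq_of_ne hne, zero_sub]
  have hu₀_supp : u₀ ∈ (single e (1 : k) - g).coeff.support := by
    rw [Finsupp.mem_support_iff, hf_u u₀ hu₀, neg_ne_zero]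
    exact Finsupp.mem_support_iff.1 hu₀
  have hsupp : ∀ v ∈ (single e (1 : k) - g).coeff.support, v = e ∨ v ∈ g.coeff.support := by
    intro v hv
    by_contra hne
    push Not at hne
    rw [Finsupp.mem_support_iff, hf_coeff, Finsupp.single_eq_of_ne hne.1,
      Finsupp.notMem_support_iff.1 hne.2, sub_zero] at hv
    exact hv rfl
  apply AddMonoidAlgebra.coeff_injective
  ext v
  rw [coeff_initialForm_apply, coeff_neg, Finsupp.coe_neg, Pi.neg_apply]
  by_cases hv : v ∈ (single e (1 : k) - g).coeff.support
  · rcases hsupp v hv with rfl | hvg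
    · rw [if_neg, hge, neg_zero]
      intro hall
      have := hall u₀ hu₀_supp
      rw [he, hg0 u₀ hu₀] at this
      exact absurd this (by norm_num)
    · rw [if_pos, hf_u v hvg]
      intro u hu
      rcases hsupp u hu with rfl | hug
      · rw [hg0 v hvg, he]; exact zero_le_one
      · rw [hg0 v hvg, hg0 u hug]
  · have hv0 : (single e (1 : k) - g).coeff v = 0 := Finsupp.notMem_support_iff.1 hv
    have hvg : g.coeff v = 0 := by
      by_contra hne
      exact hv (by rw [Finsupp.mem_support_iff, hf_u v (Finsupp.mem_support_iff.2 hne), neg_ne_zero]; exact hne)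
    rw [hv0, hvg, neg_zero]
    split <;> rfl

/-- **… and `ι G₀ ∈ in_w(I')`** (the initial form of the generator `y − ι G₀` at the leg is `−ι G₀`), so
`(ι G₀) ≤ in_w(I')`. [folklore] -/
theorem inductiveStep_torusLeg_span_le_inIdeal (k : Type) [Field k] (N : ℕ)
    (G : Fin 1 → AddMonoidAlgebra k (Fin N → ℤ)) (hG : G 0 ≠ 0) :
    Ideal.span {(AddMonoidAlgebra.ofCoeff ((G 0).coeff.mapDomain fun v => Fin.append v (0 : Fin 1 → ℤ)) : AddMonoidAlgebra k (Fin (N + 1) → ℤ))} ≤ weightInitialIdeal (Fin.append (0 : Fin N → ℤ) (1 : Fin 1 → ℤ)) (Ideal.span ((fun f : AddMonoidAlgebra k (Fin N → ℤ) => (AddMonoidAlgebra.ofCoeff (f.coeff.mapDomain fun v => Fin.append v (0 : Fin 1 → ℤ)) : AddMonoidAlgebra k (Fin (N + 1) → ℤ))) '' (↑(⊥ : Ideal (AddMonoidAlgebra k (Fin N → ℤ))) : Set (AddMonoidAlgebra k (Fin N → ℤ))) ∪ Set.range (fun j : Fin 1 => AddMonoidAlgebra.single (Fin.append (0 : Fin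 N → ℤ) (Pi.single j (1 : ℤ))) (1 : k) - AddMonoidAlgebra.ofCoeff ((G j).coeff.mapDomain fun v => Fin.append v (0 : Fin 1 → ℤ))))) := by
  rw [Ideal.span_le, Set.singleton_subset_iff, SetLike.mem_coe]
  have hmem : (AddMonoidAlgebra.single (Fin.append (0 : Fin N → ℤ) (Pi.single (0 : Fin 1) (1 : ℤ))) (1 : k) - (AddMonoidAlgebra.ofCoeff ((G 0).coeff.mapDomain fun v => Fin.append v (0 : Fin 1 → ℤ)) : AddMonoidAlgebra k (Fin (N + 1) → ℤ))) ∈ Ideal.span ((fun f : AddMonoidAlgebra k (Fin N → ℤ) => (AddMonoidAlgebra.ofCoeff (f.coeff.mapDomain fun v => Fin.append v (0 : Fin 1 → ℤ)) : AddMonoidAlgebra k (Fin (N + 1) → ℤ))) '' (↑(⊥ : Ideal (AddMonoidAlgebra k (Fin N → ℤ))) : Set (AddMonoidAlgebra k (Fin N → ℤ))) ∪ Set.range (fun j : Fin 1 => AddMonoidAlgebra.single (Fin.append (0 : Fin N → ℤ) (Pi.single j (1 : ℤ))) (1 : k) - AddMonoidAlgebra.ofCoeff ((G j).coeff.mapDomain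 fun v => Fin.append v (0 : Fin 1 → ℤ)))) :=
    Ideal.subset_span (Or.inr ⟨0, rfl⟩)
  have hin := initialForm_mem_initialIdeal (dotWeight (Fin.append (0 : Fin N → ℤ) (1 : Fin 1 → ℤ))) hmem
  rw [inductiveStep_torusLeg_initialForm_single_sub] at hin
  · exact neg_mem_iff.1 hin
  · -- `ι G₀ ≠ 0`
    intro h0
    apply hG
    have h1 := congrArg AddMonoidAlgebra.coeff h0
    rw [coeff_zero] at h1
    change Finsupp.mapDomain (fun v => Fin.append v (0 : Fin 1 → ℤ)) (G 0).coeff = 0 at h1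
    have hinjF : Function.Injective (fun v : Fin N → ℤ => Fin.append v (0 : Fin 1 → ℤ)) := by
      intro u v huv
      funext i
      have := congrFun huv (Fin.castAdd 1 i)
      simpa only [Fin.append_left] using this
    rw [← coeff_eq_zero]
    exact Finsupp.mapDomain_injective hinjF (by rw [h1, Finsupp.mapDomain_zero])
  · rw [inductiveStep_torusLeg_dotWeight, Fin.append_right, Pi.single_eq_same]
  · intro u hu
    change u ∈ (Finsupp.mapDomain (fun v => Fin.append v (0 : Fin 1 → ℤ)) (G 0).coeff).support at hu
    obtain ⟨u', _, rfl⟩ := Finset.mem_image.1 (Finsupp.mapDomain_support hu)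
    rw [inductiveStep_torusLeg_dotWeight, Fin.append_right, Pi.zero_apply]

/-- **The degeneration of `𝔾_m^N ∖ V(G₀)` at the leg weight `(0,…,0,1)` IS `V(G₀) × 𝔾_m`**:
`in_w⟨ι(⊥), y − ι G₀⟩ = (ι G₀)` in `k[ℤ^(N+1)]`, for every field `k` and every `G₀ ≠ 0`.  So the
re-embedded principal open `U[G₀⁻¹]` of the torus can only be schön if the removed hypersurface
`V(G₀) ∩ 𝔾_m^N` is REGULAR (and, reading the other legs, schön): the "new boundary must be smooth"
input (Bertini, step (iii) of the crux's intended proof) is load-bearing — see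
`TorusLegNode.lean` for a `G₀` where the clause fails. [folklore] -/
theorem inductiveStep_torusLeg_inIdeal_eq_span (k : Type) [Field k] (N : ℕ)
    (G : Fin 1 → AddMonoidAlgebra k (Fin N → ℤ)) (hG : G 0 ≠ 0) :
    weightInitialIdeal (Fin.append (0 : Fin N → ℤ) (1 : Fin 1 → ℤ)) (Ideal.span ((fun f : AddMonoidAlgebra k (Fin N → ℤ) => (AddMonoidAlgebra.ofCoeff (f.coeff.mapDomain fun v => Fin.append v (0 : Fin 1 → ℤ)) : AddMonoidAlgebra k (Fin (N + 1) → ℤ))) '' (↑(⊥ : Ideal (AddMonoidAlgebra k (Fin N → ℤ))) : Set (AddMonoidAlgebra k (Fin N → ℤ))) ∪ Set.range (fun j : Fin 1 => AddMonoidAlgebra.single (Fin.append (0 : Fin N → ℤ) (Pi.single j (1 : ℤ))) (1 : k) - AddMonoidAlgebra.ofCoeff ((G j).coeff.mapDomain fun v => Fin.append v (0 : Fin 1 → ℤ))))) = Ideal.span {(AddMonoidAlgebra.ofCoeff ((G 0).coeff.mapDomain fun v => Fin.append v (0 : Fin 1 → ℤ)) : AddMonoidAlgebra k (Fin (N + 1)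 → ℤ))} :=
  le_antisymm (inductiveStep_torusLeg_inIdeal_le_span k N G hG) (inductiveStep_torusLeg_span_le_inIdeal k N G hG)

end Summit.ResolutionOfSingularities.ResolutionOfSingularities.Theorems.InductiveStep.Negative
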